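import Literature.Probability.Percolation.UniquenessInfiniteCluster
import Literature.Probability.Percolation.BondPercolationSymmetry

/-!
# `ClassUniqueness` (route PercMonotoneFactors, item stmt-CriticalPhenomena-4493) — the block-factor law

Helper file for `PercMonotoneFactorsClassUniqueness.lean`. For a **monotone finite-range block
rule** `F` on bond configurations of `ℤ^d` — monotone, `F E = E`, `E`-supported
(`F ω ⊆ E` for `ω ⊆ E`, `E = E(ℤ^d)`), equivariant under translations, and local of range `R`
(the state of `e` in `F ω` depends only on the labels `ω e'` of pairs `e'` with an endpoint at
sup-distance `≤ R` from an endpoint of `e`) — the image law `μ_t^F = F_* P_t` of Bernoulli bond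
percolation satisfies the four hypotheses of the uniqueness theorem for "sandwich insertion
tolerant" laws (`Literature.Probability.Percolation.ae_numInfiniteClusters_le_one_of_sandwich`,
`Literature/Probability/Percolation/UniquenessSandwichTolerant.lean`, landing separately):

* `edgesIn_box_subset_factor_openEdges` — opening all LABELS of `Λ_{N+R+1}` opens every OUTPUT
  edge of `Λ_N` (locality + `F E = E`);
* `mem_edgesIn_of_mem_factor_openEdges` — and changes no output edge outside `Λ_{N+2R+2}`
  (locality);
* `factorLaw_sandwich` — hence the output law is **sandwich insertion tolerant** with
  `N' = N + 2R + 2`, by the insertion tolerance `p^{|F|} P_p{ω ∪ F ∈ ·} ≤ P_p(·)` of the labels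
  (`bondPercolation_pow_mul_real_preimage_openEdges_le`) — although it need not be insertion
  tolerant itself (e.g. `F_e(ω) = ω_e ∧ ⋀_{e' ∼ e} ω_{e'}`);
* `factorLaw_measurePreserving_shift`, `factorLaw_zero_one`, `factorLaw_ae_subset` — translation
  invariance, ergodicity (invariant events pull back to invariant events of `P_t`,
  `bondPercolation_zero_one_of_relabel_shift`) and lattice support.

All statements are over the tree's `bondPercolation`, `openEdges`, `edgesIn`, `box`,
`BondConfig.relabel`; the hypotheses are those of the route decl `ClassUniqueness` verbatim
(for general `d`).
-/

noncomputable section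

namespace Summit.CriticalPhenomena.PercolationContinuityZ3.Theorems

open MeasureTheory ProbabilityTheory SimpleGraph Finset
open Literature.Probability.Percolation Literature.Probability.LatticeModels
open scoped ENNReal

variable {d : ℕ}

/-! ### Lattice geometry of the locality relation -/

/-- A site at sup-distance `≤ R` from a site of `Λ_N` lies in `Λ_{N+R}`. [folklore] -/
theorem mem_box_of_abs_sub_le {N R : ℕ} {x y : Site d} (hx : x ∈ box d N)
    (hxy : ∀ i, |x i - y i| ≤ (R : ℤ)) : y ∈ box d (N + R) := by
  rw [mem_box] at hx ⊢
  intro i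
  have h1 := hx i
  have h2 := abs_le.1 (hxy i)
  push_cast
  omega

/-- If a pair `e'` of `E(ℤ^d)` has an endpoint at sup-distance `≤ R` from a site `x ∈ Λ_N`, then
both endpoints of `e'` lie in `Λ_{N+R+1}`. [folklore] -/
theorem mem_edgesIn_of_near {N R : ℕ} {x : Site d} (hx : x ∈ box d N) {e' : Sym2 (Site d)}
    (he' : e' ∈ (zdGraph d).edgeSet) (hy : ∃ y ∈ e', ∀ i, |x i - y i| ≤ (R : ℤ)) :
    e' ∈ edgesIn (zdGraph d) (box d (N + R + 1)) := by
  obtain ⟨y, hy, hxy⟩ := hy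
  have hybox : y ∈ box d (N + R) := mem_box_of_abs_sub_le hx hxy
  rw [mem_edgesIn_iff]
  refine ⟨he', fun z hz => ?_⟩
  induction e' using Sym2.ind with
  | h a b =>
    rw [mem_edgeSet] at he'
    rcases Sym2.mem_iff.1 hy with rfl | rfl <;> rcases Sym2.mem_iff.1 hz with rfl | rfl
    · exact box_mono d (Nat.le_succ _) hybox
    · exact mem_box_succ_of_adj hybox he'
    · exact mem_box_succ_of_adj hybox he'.symm
    · exact box_mono d (Nat.le_succ _) hybox

/-! ### Opening the labels of a box -/

/-- **Opening all labels of `Λ_{N+R+1}` opens every output edge of `Λ_N`.** For a lattice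
configuration `ω ⊆ E`, a rule `F` with `F E = E`, local of range `R`: every pair `e'` within range
of an edge `e` of `Λ_N` is an edge of `Λ_{N+R+1}` (if it is in `E`) or is closed in both
`ω ∪ E(Λ_{N+R+1})` and `E`, so `e ∈ F(ω ∪ E(Λ_{N+R+1})) ↔ e ∈ F E = E`. [folklore] -/
theorem edgesIn_box_subset_factor_openEdges {R N : ℕ} {F : BondConfig (Site d) → BondConfig (Site d)}
    (hE : F (zdGraph d).edgeSet = (zdGraph d).edgeSet)
    (hloc : ∀ (ω ω' : BondConfig (Site d)) (e : Sym2 (Site d)),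
      (∀ e' : Sym2 (Site d), (∃ x ∈ e, ∃ y ∈ e', ∀ i, |x i - y i| ≤ (R : ℤ)) → (e' ∈ ω ↔ e' ∈ ω')) → (e ∈ F ω ↔ e ∈ F ω'))
    {ω : BondConfig (Site d)} (hω : ω ⊆ (zdGraph d).edgeSet) :
    (↑(edgesIn (zdGraph d) (box d N)) : Set (Sym2 (Site d))) ⊆
      F (openEdges ↑(edgesIn (zdGraph d) (box d (N + R + 1))) ω) := by
  intro e he
  rw [Finset.mem_coe, mem_edgesIn_iff] at he
  refine (hloc _ (zdGraph d).edgeSet e fun e' hnear => ?_).2 (by rw [hE]; exact he.1)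
  obtain ⟨x, hx, y, hy, hxy⟩ := hnear
  constructor
  · rintro (h | h)
    · exact hω h
    · exact (mem_edgesIn_iff.1 h).1
  · intro he'E
    exact Or.inr (mem_edgesIn_of_near (he.2 x hx) he'E ⟨y, hy, hxy⟩)

/-- **Opening the labels of `Λ_{N+R+1}` changes no output edge outside `Λ_{N+2R+2}`.** For a
lattice configuration `ω ⊆ E` and an `E`-supported rule `F` local of range `R`: an output edge
of `F(ω ∪ E(Λ_{N+R+1}))` which is not an output edge of `F ω` has an endpoint within range of an
edge of `Λ_{N+R+1}`, hence both endpoints in `Λ_{N+2R+2}`. [folklore] -/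
theorem mem_edgesIn_of_mem_factor_openEdges {R N : ℕ} {F : BondConfig (Site d) → BondConfig (Site d)}
    (hsupp : ∀ ω : BondConfig (Site d), ω ⊆ (zdGraph d).edgeSet → F ω ⊆ (zdGraph d).edgeSet)
    (hloc : ∀ (ω ω' : BondConfig (Site d)) (e : Sym2 (Site d)),
      (∀ e' : Sym2 (Site d), (∃ x ∈ e, ∃ y ∈ e', ∀ i, |x i - y i| ≤ (R : ℤ)) → (e' ∈ ω ↔ e' ∈ ω')) → (e ∈ F ω ↔ e ∈ F ω'))
    {ω : BondConfig (Site d)} (hω : ω ⊆ (zdGraph d).edgeSet) {e : Sym2 (Site d)}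
    (he : e ∈ F (openEdges ↑(edgesIn (zdGraph d) (box d (N + R + 1))) ω)) (hne : e ∉ F ω) :
    e ∈ edgesIn (zdGraph d) (box d (N + 2 * R + 2)) := by
  have hω' : openEdges ↑(edgesIn (zdGraph d) (box d (N + R + 1))) ω ⊆ (zdGraph d).edgeSet := by
    rintro e' (h | h)
    · exact hω h
    · exact (mem_edgesIn_iff.1 h).1
  have heE : e ∈ (zdGraph d).edgeSet := hsupp _ hω' he
  by_contra hcon
  refine hne ((hloc ω _ e fun e' hnear => ?_).2 he)
  obtain ⟨x, hx, y, hy, hxy⟩ := hnear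
  constructor
  · exact fun h => Or.inl h
  · rintro (h | h)
    · exact h
    · exfalso
      -- `e' ∈ E(Λ_{N+R+1})`, so `e` lies in `Λ_{N+2R+2}`
      have hybox : y ∈ box d (N + R + 1) := (mem_edgesIn_iff.1 h).2 y hy
      have hyx : ∀ i, |y i - x i| ≤ (R : ℤ) := fun i => by rw [abs_sub_comm]; exact hxy i
      have := mem_edgesIn_of_near hybox heE ⟨x, hx, hyx⟩
      have heq : N + R + 1 + R + 1 = N + 2 * R + 2 := by ring
      rw [heq] at this
      exact hcon this

/-! ### The block-factor law -/

/-- The event `{η | η ⊆ E}` of lattice configurations is measurable. [folklore] -/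
theorem measurableSet_setOf_subset_edgeSet (E : Set (Sym2 (Site d))) :
    MeasurableSet {η : BondConfig (Site d) | η ⊆ E} := by
  have heq : {η : BondConfig (Site d) | η ⊆ E} = ⋂ e : Sym2 (Site d), {η | e ∈ η → e ∈ E} := by
    ext η; simp [Set.subset_def]
  rw [heq]
  refine MeasurableSet.iInter fun e => ?_
  by_cases he : e ∈ E
  · simp only [he, imp_true_iff, Set.setOf_true]; exact MeasurableSet.univ
  · simp only [he, imp_false]
    exact (measurableSet_mem e).compl

/-- **The block-factor law is carried by lattice configurations** (`F` is `E`-supported and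
`P_t`-a.s. `ω ⊆ E`). [folklore] -/
theorem factorLaw_ae_subset {F : BondConfig (Site d) → BondConfig (Site d)} (hF : Measurable F)
    (hsupp : ∀ ω : BondConfig (Site d), ω ⊆ (zdGraph d).edgeSet → F ω ⊆ (zdGraph d).edgeSet) (t : unitInterval) :
    ∀ᵐ η ∂((bondPercolation (zdGraph d) t).map F), η ⊆ (zdGraph d).edgeSet := by
  rw [ae_map_iff hF.aemeasurable (measurableSet_setOf_subset_edgeSet _)]
  filter_upwards [setBernoulli_ae_subset (u := (zdGraph d).edgeSet) (p := t)] with ω hω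
  exact hsupp ω hω

/-- Relabelling along a translation is the image under `Sym2.map` of the translation
isomorphism `zdShiftIso v` (definitional bookkeeping between the route's `Sym2.map φ '' ω` and
the tree's `BondConfig.relabel`). [folklore] -/
theorem relabel_shift_eq_image (v : Site d) (ω : BondConfig (Site d)) :
    BondConfig.relabel (sym2Equiv (Site.shift v)) ω = Sym2.map (zdShiftIso v) '' ω := rfl

/-- **Translation invariance of the block-factor law** (`F` equivariant under translations and
`P_t` translation invariant, `bondPercolation_map_shift`). [folklore] -/
theorem factorLaw_measurePreserving_shift {F : BondConfig (Site d) → BondConfig (Site d)} (hF : Measurable F)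
    (hequiv : ∀ (φ : zdGraph d ≃g zdGraph d) (ω : BondConfig (Site d)), F (Sym2.map φ '' ω) = Sym2.map φ '' (F ω))
    (t : unitInterval) (v : Site d) :
    MeasurePreserving (BondConfig.relabel (sym2Equiv (Site.shift v)))
      ((bondPercolation (zdGraph d) t).map F) ((bondPercolation (zdGraph d) t).map F) := by
  refine ⟨(BondConfig.relabel (sym2Equiv (Site.shift v))).measurable, ?_⟩
  have hcomm : (BondConfig.relabel (sym2Equiv (Site.shift v))) ∘ F = F ∘ (BondConfig.relabel (sym2Equiv (Site.shift v))) := by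
    funext ω
    simp only [Function.comp_apply, relabel_shift_eq_image]
    exact (hequiv (zdShiftIso v) ω).symm
  rw [Measure.map_map (BondConfig.relabel (sym2Equiv (Site.shift v))).measurable hF, hcomm,
    ← Measure.map_map hF (BondConfig.relabel (sym2Equiv (Site.shift v))).measurable, bondPercolation_map_shift]

/-- **Ergodicity of the block-factor law**: an event invariant under all translations has
probability `0` or `1` (its preimage under the equivariant `F` is a translation-invariant event of
`P_t`, `bondPercolation_zero_one_of_relabel_shift`; `d ≥ 1`). [folklore] -/
theorem factorLaw_zero_one (hd : 1 ≤ d) {F : BondConfig (Site d) → BondConfig (Site d)} (hF : Measurable F)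
    (hequiv : ∀ (φ : zdGraph d ≃g zdGraph d) (ω : BondConfig (Site d)), F (Sym2.map φ '' ω) = Sym2.map φ '' (F ω))
    (t : unitInterval) (S : Set (BondConfig (Site d))) (hS : MeasurableSet S)
    (hinv : ∀ v : Site d, BondConfig.relabel (sym2Equiv (Site.shift v)) ⁻¹' S = S) :
    (bondPercolation (zdGraph d) t).map F S = 0 ∨ (bondPercolation (zdGraph d) t).map F S = 1 := by
  rw [Measure.map_apply hF hS]
  set v : Site d := Pi.single ⟨0, hd⟩ 1 with hv
  have hv0 : v ≠ 0 := single_ne_zero hd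
  refine bondPercolation_zero_one_of_relabel_shift t hv0 (hF hS) ?_
  ext ω
  simp only [Set.mem_preimage, relabel_shift_eq_image, hequiv (zdShiftIso v) ω]
  rw [← relabel_shift_eq_image, ← Set.mem_preimage, hinv v]

/-- The event "every sandwich modification `η ∪ D`, `E(Λ_N) ⊆ D ⊆ E(Λ_{N'})`, lies in `S`" is
measurable (countably many conditions). [folklore] -/
theorem measurableSet_setOf_forall_openEdges (N N' : ℕ) {S : Set (BondConfig (Site d))} (hS : MeasurableSet S) :
    MeasurableSet {η : BondConfig (Site d) | ∀ D : Finset (Sym2 (Site d)), edgesIn (zdGraph d) (box d N) ⊆ D →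
      D ⊆ edgesIn (zdGraph d) (box d N') → openEdges ↑D η ∈ S} := by
  have heq : {η : BondConfig (Site d) | ∀ D : Finset (Sym2 (Site d)), edgesIn (zdGraph d) (box d N) ⊆ D →
      D ⊆ edgesIn (zdGraph d) (box d N') → openEdges ↑D η ∈ S} =
      ⋂ D : Finset (Sym2 (Site d)), {η | edgesIn (zdGraph d) (box d N) ⊆ D → D ⊆ edgesIn (zdGraph d) (box d N') → openEdges ↑D η ∈ S} := by
    ext η; simp
  rw [heq]
  refine MeasurableSet.iInter fun D => ?_
  by_cases h1 : edgesIn (zdGraph d) (box d N) ⊆ D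
  · by_cases h2 : D ⊆ edgesIn (zdGraph d) (box d N')
    · simp only [h1, h2, forall_true_left]
      exact measurable_openEdges _ hS
    · simp only [h2, false_imp_iff, imp_true_iff, Set.setOf_true]; exact MeasurableSet.univ
  · simp only [h1, false_imp_iff, Set.setOf_true]; exact MeasurableSet.univ

/-- **Sandwich insertion tolerance of the block-factor law.** For `t > 0` and a measurable,
monotone, `E`-supported rule `F` with `F E = E`, local of range `R`: if `μ_t^F(S) = 0` then
`μ_t^F`-a.s. some modification `η ∪ D` with `E(Λ_N) ⊆ D ⊆ E(Λ_{N+2R+2})` avoids `S`. Indeed for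
`P_t`-a.e. `ω`, `F(ω ∪ E(Λ_{N+R+1})) = F ω ∪ D(ω)` with such a `D(ω)` (monotonicity and the two
locality lemmas), and `P_t{ω | F(ω ∪ E(Λ_{N+R+1})) ∈ S} ≤ t^{-|E(Λ_{N+R+1})|} P_t(F⁻¹ S) = 0`
(insertion tolerance of the labels). [folklore] -/
theorem factorLaw_sandwich {R : ℕ} {F : BondConfig (Site d) → BondConfig (Site d)} (hF : Measurable F)
    (hmono : Monotone F) (hE : F (zdGraph d).edgeSet = (zdGraph d).edgeSet)
    (hsupp : ∀ ω : BondConfig (Site d), ω ⊆ (zdGraph d).edgeSet → F ω ⊆ (zdGraph d).edgeSet)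
    (hloc : ∀ (ω ω' : BondConfig (Site d)) (e : Sym2 (Site d)),
      (∀ e' : Sym2 (Site d), (∃ x ∈ e, ∃ y ∈ e', ∀ i, |x i - y i| ≤ (R : ℤ)) → (e' ∈ ω ↔ e' ∈ ω')) → (e ∈ F ω ↔ e ∈ F ω'))
    {t : unitInterval} (ht : 0 < (t : ℝ)) (N : ℕ) :
    ∃ N' : ℕ, N ≤ N' ∧ ∀ S : Set (BondConfig (Site d)), MeasurableSet S → (bondPercolation (zdGraph d) t).map F S = 0 →
      (bondPercolation (zdGraph d) t).map F {η | ∀ D : Finset (Sym2 (Site d)), edgesIn (zdGraph d) (box d N) ⊆ D →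
        D ⊆ edgesIn (zdGraph d) (box d N') → openEdges ↑D η ∈ S} = 0 := by
  classical
  set P := bondPercolation (zdGraph d) t with hP
  set L := edgesIn (zdGraph d) (box d (N + R + 1)) with hL
  refine ⟨N + 2 * R + 2, by omega, fun S hS h0 => ?_⟩
  set T := {η : BondConfig (Site d) | ∀ D : Finset (Sym2 (Site d)), edgesIn (zdGraph d) (box d N) ⊆ D →
    D ⊆ edgesIn (zdGraph d) (box d (N + 2 * R + 2)) → openEdges ↑D η ∈ S} with hT
  have hTm : MeasurableSet T := measurableSet_setOf_forall_openEdges N _ hS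
  rw [Measure.map_apply hF hS] at h0
  rw [Measure.map_apply hF hTm]
  -- the modified label configuration lands in `S` on `F⁻¹ T` (for lattice `ω`)
  have hsub : F ⁻¹' T ∩ {ω | ω ⊆ (zdGraph d).edgeSet} ⊆ openEdges (↑L : Set (Sym2 (Site d))) ⁻¹' (F ⁻¹' S) := by
    rintro ω ⟨hωT, hωE⟩
    set D : Finset (Sym2 (Site d)) := (edgesIn (zdGraph d) (box d (N + 2 * R + 2))).filter
      fun e => e ∈ F (openEdges ↑L ω) with hD
    have hD1 : edgesIn (zdGraph d) (box d N) ⊆ D := by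
      intro e he
      rw [hD, Finset.mem_filter]
      refine ⟨?_, edgesIn_box_subset_factor_openEdges hE hloc hωE (Finset.mem_coe.2 he)⟩
      rw [mem_edgesIn_iff] at he ⊢
      exact ⟨he.1, fun x hx => box_mono d (by omega) (he.2 x hx)⟩
    have hD2 : D ⊆ edgesIn (zdGraph d) (box d (N + 2 * R + 2)) := Finset.filter_subset _ _
    have heq : openEdges (↑D : Set (Sym2 (Site d))) (F ω) = F (openEdges ↑L ω) := by
      ext e
      simp only [mem_openEdges, Finset.mem_coe, hD, Finset.mem_filter]
      constructor
      · rintro (h | ⟨-, h⟩)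
        · exact hmono (subset_openEdges _ ω) h
        · exact h
      · intro h
        by_cases h' : e ∈ F ω
        · exact Or.inl h'
        · exact Or.inr ⟨mem_edgesIn_of_mem_factor_openEdges hsupp hloc hωE h h', h⟩
    have := hωT D hD1 hD2
    rw [heq] at this
    exact this
  -- insertion tolerance of the labels
  have hpre : P.real (openEdges (↑L : Set (Sym2 (Site d))) ⁻¹' (F ⁻¹' S)) = 0 := by
    have h1 : (t : ℝ) ^ L.card * P.real (openEdges (↑L : Set (Sym2 (Site d))) ⁻¹' (F ⁻¹' S)) ≤ P.real (F ⁻¹' S) :=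
      bondPercolation_pow_mul_real_preimage_openEdges_le (zdGraph d) t L
        (fun e he => (mem_edgesIn_iff.1 (Finset.mem_coe.1 he)).1) (hF hS)
    have h2 : P.real (F ⁻¹' S) = 0 := by rw [measureReal_def, h0, ENNReal.toReal_zero]
    have h3 : 0 < (t : ℝ) ^ L.card := pow_pos ht _
    have h4 : 0 ≤ P.real (openEdges (↑L : Set (Sym2 (Site d))) ⁻¹' (F ⁻¹' S)) := measureReal_nonneg
    nlinarith
  have hpre' : P (openEdges (↑L : Set (Sym2 (Site d))) ⁻¹' (F ⁻¹' S)) = 0 :=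
    (measureReal_eq_zero_iff (measure_ne_top _ _)).1 hpre
  have hAE : P {ω : BondConfig (Site d) | ω ⊆ (zdGraph d).edgeSet}ᶜ = 0 := by
    rw [Set.compl_setOf]
    exact ae_iff.1 (setBernoulli_ae_subset (u := (zdGraph d).edgeSet) (p := t))
  rw [← measure_inter_conull hAE]
  exact measure_mono_null hsub hpre'

end Summit.CriticalPhenomena.PercolationContinuityZ3.Theorems

end
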